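import Summits.QuantumFields.BalabanUV.Beta.D1BFx.GhostStencil
import Summits.QuantumFields.BalabanUV.Beta.FP.BubbleGermValue

/-!
# `BalabanUV.Beta.FP.GhostCubicGerm` — road «FP» for binder row D1, row H2V-3 (owner b2b-balaban-beta-d1-p3, R-FP-23 ∕ `H2V-DESIGN.md` §4):
# THE CUBIC GERM OF THE UNIT-LATTICE GHOST STENCIL IS `ghostGerm` — `cubicGermOfSc ghCur = BubbleGermValue.ghostGerm`, coefficient EXACTLY ONE

HONEST DEPENDENCY (page 1, mandatory): continuum YM on T⁴ ⇐ BetaPertH ∧ nine spine estimates (0/9 proved); BetaPertH ⇐ (D1) ∧ (D4) ∧ CAP+tail;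
G-an2-4 gates asym, D1 and NE2/3/4.  HONEST FRAMING (cell contract, verbatim): «discharging `BetaPertH` makes Bałaban's UV stability UNCONDITIONAL —
a real constructive-QFT result; it is NOT the continuum limit and NOT the Clay problem.»  THIS MODULE DISCHARGES NOTHING of the wall: two finitely
supported `HasSum`s on `ℤ⁴ × ℤ⁴` and Kronecker deltas.  `[our object]`∕`[folklore]`; nothing cited, no `def … : Prop`, no `sorry`.  NOT the ghost LEG
(`PerfectPolarization.G0ker`, `ConstrainedGhost`), NOT the ghost colour weight `wgh` (H2-ASM-4), NOT H2-ASM, NOT hgerm, NOT D1, NOT BetaPertH, NOT continuum,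
NOT Clay.

ABSOLUTE RULE (cell charter, verbatim): «No internally-minted statement may enter as a cited fact. Every hypothesis is either kernel-proved in this package or a
verbatim quotation of a PUBLISHED theorem with page reference. The manuscript(s) under audit are NOT citable for their own disputed steps — they are the thing
under adjudication; programme-internal (2001/route/tribunal) claims are never citable.»

THE GHOST STENCIL IS ALREADY IN THE TREE — this row only reads its germ.  DERIVATION CHAIN (all BY NAME, nothing re-typed):
(i) an3's `Literature…Beta.GhostTable.lapFamily_expand` ∕ `vertex₁_eq_current`: the first `t`-jet of the bond-Laplacian family
`(fwdDiff e + t·E_{x,x+e}⊗A)ᵀ(fwdDiff e + t·E_{x,x+e}⊗A) + R` of the lattice adjoint covariant Laplacian `D_U*D_U` on `𝔤`-valued scalars, twisted to first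
order on ONE bond by a skew colour matrix `A`, IS the antisymmetric lattice current `current x e A = E_{x+e,x}⊗A − E_{x,x+e}⊗A` (ROW = `c̄`, COLUMN = `c`);
(ii) the D1 typer's `D1BFx.GhostStencil.ghCur κ′ u : MKer 4 Unit` = its `ℤ⁴` transcription at `C := Unit` in the `ad(t_c)`-coefficient (colour-stripped)
convention of `StepJetData` §5: `ghCur κ′ u x z = [x = u + e_{κ′}][z = u] − [x = u][z = u + e_{κ′}]`, with the sockets `ghCur_antisymm`, `ghCur_translate`
(letter (a2)), `biLoc_ghCur : BiLoc (ghCur κ′ u) u u e^{δ} δ` (letter (a1)) — NO block averaging (the unit-lattice FP operator of H2-DESIGN §2∕§5; the blocked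
pieces `qAnti`∕`Sgh` of that file are NOT used here).  `ghCur` has exactly the type of the ghost cubic slot `v : Fin 4 → Site 4 → MKer 4 Unit` of H2V-0's
`PerfectPolarization.PiBF`.

WHAT IS PROVED.
* §1 `cubicGermOfSc S λ κ i := Σ'_{(x,z) ∈ ℤ⁴×ℤ⁴} S λ 0 x z () () · (x_κ if i = 0, z_κ if i = 1)` — [our object] the SCALAR-FIBRE cubic germ functional (the
  `Unit`-fibre twin of `WilsonCubicGerm.cubicGermOf`, same INDEX CONVENTION: leg 1 = the ROW leg `x` = `c̄`, momentum `p`; leg 2 = the COLUMN leg `z` = `c`,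
  momentum `q`; leg 3 = the background bond `(0, λ)`).
* §2 `hasSum_ghCur_mul` (pairing against ANY weight: `φ(e_λ, 0) − φ(0, e_λ)`), `hasSum_ghCur_mul_at` (any bond site `u`, weight read relative to `u`),
  **`tsum_ghCur_eq_zero`** (TOTAL mass zero — the zero-mass letter of H2-ASM-1's smear expansion; LOCATED `ghCur_rowLeg`: the leg-wise masses of a pure
  hopping current do NOT vanish), and **`cubicGermOfSc_ghCur : cubicGermOfSc ghCur = ghostGerm`** — t4-ne9-formalise-leaf-03's ghost germ
  `ghostGerm λ κ i = sgn i · δ_{λκ}` (`B_λ (p − q)_λ c̄ c`, `BubbleGermValue`), whose loop on free legs is `ghostLoop = ghostBubble = S` (`ghostLoop_eq`), IS the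
  germ of the lattice ghost stencil, coefficient EXACTLY ONE in `GhostTable`'s normalisation (transporter `1 + t·A` on the twisted bond; the identification of
  `(t, A)` with Bałaban's `(B, ad)` is the SAME stripping step as the gluon sector's, and the overall sign of `ghostGerm` is immaterial to `ghostLoop`, which is
  quadratic in it).
Provenance: G-an2-4 formalisation swarm seat b2b-balaban-gan24-formalise-leaf-02 gen 38 (cross-lane on road FP, first refusal R-FP-23 (c)), 2026-08-21.
-/

noncomputable section

namespace Summit.QuantumFields.BalabanUV.Beta.FP.GhostCubicGerm

open Finset
open scoped BigOperators
open Literature.MathematicalPhysics.QuantumFieldTheory.Balaban1983to89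
open Literature.MathematicalPhysics.QuantumFieldTheory.Balaban1983to89.Beta
open ExpKernelCalculus (Site MKer BiLoc shiftK)
open AffineAveraging (unitVec unitVec_apply)
open Summit.QuantumFields.BalabanUV.Beta.D1BFx.GhostStencil (ghCur ghCur_apply ghCur_translate ghCur_antisymm biLoc_ghCur unitVec_ne_zero)
open Summit.QuantumFields.BalabanUV.Beta.FP.MarginalUniqueness (δ)
open Summit.QuantumFields.BalabanUV.Beta.FP.BubbleGermValue (sgn ghostGerm)

/-! ## §1 The scalar-fibre cubic germ functional -/

/-- [our object] **THE SCALAR-FIBRE CUBIC GERM** of a `Unit`-fibred first-order stencil family on `ℤ⁴` (background bond `(λ, u)` ↦ kernel):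
`cubicGermOfSc S λ κ i = Σ'_{(x,z)} S λ 0 x z () () · (x_κ if i = 0, z_κ if i = 1)` — the first moments, relative to the background site, of the member with
background bond `(λ, 0)`; the `Unit`-fibre twin of `WilsonCubicGerm.cubicGermOf`.  A definition asserting nothing. -/
def cubicGermOfSc (S : Fin 4 → Site 4 → MKer 4 Unit) (lam κ : Fin 4) (i : Fin 2) : ℝ :=
  ∑' xz : Site 4 × Site 4, S lam 0 xz.1 xz.2 () () * (((if i = 0 then xz.1 κ else xz.2 κ : ℤ)) : ℝ)

/-! ## §2 The pairing of the ghost current against a weight, its total mass, its germ -/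

/-- [folklore] an indicator of ONE point of `ℤ⁴ × ℤ⁴` times a weight has sum the weight at that point. -/
theorem hasSum_ite_pair_mul (x₀ z₀ : Site 4) (φ : Site 4 → Site 4 → ℝ) :
    HasSum (fun xz : Site 4 × Site 4 => (if xz.1 = x₀ ∧ xz.2 = z₀ then (1 : ℝ) else 0) * φ xz.1 xz.2) (φ x₀ z₀) := by
  have h : HasSum (fun xz : Site 4 × Site 4 => (if xz.1 = x₀ ∧ xz.2 = z₀ then (1 : ℝ) else 0) * φ xz.1 xz.2)
      ((fun xz : Site 4 × Site 4 => (if xz.1 = x₀ ∧ xz.2 = z₀ then (1 : ℝ) else 0) * φ xz.1 xz.2) (x₀, z₀)) := by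
    refine hasSum_single _ fun xz hxz => ?_
    rw [if_neg, zero_mul]
    rintro ⟨h1, h2⟩
    exact hxz (Prod.ext h1 h2)
  simpa using h

/-- [folklore] **THE PAIRING DICTIONARY**: for EVERY weight `φ` on pairs of sites, `Σ'_{(x,z)} ghCur λ 0 x z · φ x z = φ(e_λ, 0) − φ(0, e_λ)`. -/
theorem hasSum_ghCur_mul (lam : Fin 4) (φ : Site 4 → Site 4 → ℝ) :
    HasSum (fun xz : Site 4 × Site 4 => ghCur lam 0 xz.1 xz.2 () () * φ xz.1 xz.2) (φ (unitVec lam) 0 - φ 0 (unitVec lam)) := by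
  have h1 := hasSum_ite_pair_mul (unitVec lam) 0 φ
  have h2 := hasSum_ite_pair_mul 0 (unitVec lam) φ
  refine (h1.sub h2).congr_fun fun xz => ?_
  rw [ghCur_apply, zero_add, sub_mul]

/-- [folklore] the `∑'` form of the pairing dictionary. -/
theorem tsum_ghCur_mul (lam : Fin 4) (φ : Site 4 → Site 4 → ℝ) :
    ∑' xz : Site 4 × Site 4, ghCur lam 0 xz.1 xz.2 () () * φ xz.1 xz.2 = φ (unitVec lam) 0 - φ 0 (unitVec lam) :=
  (hasSum_ghCur_mul lam φ).tsum_eq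

/-- [folklore] **TRANSLATION COVARIANCE OF THE PAIRING**: the member with background bond `(λ, u)` at ANY site `u`, paired against the weight read
RELATIVE TO `u` (`ghCur_translate` + re-indexing `ℤ⁴ × ℤ⁴`). -/
theorem hasSum_ghCur_mul_at (lam : Fin 4) (u : Site 4) (φ : Site 4 → Site 4 → ℝ) :
    HasSum (fun xz : Site 4 × Site 4 => ghCur lam u xz.1 xz.2 () () * φ (xz.1 - u) (xz.2 - u)) (φ (unitVec lam) 0 - φ 0 (unitVec lam)) := by
  have h := hasSum_ghCur_mul lam φ
  have ht := ghCur_translate lam 0 u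
  rw [zero_add] at ht
  refine (((Equiv.addRight u).prodCongr (Equiv.addRight u)).hasSum_iff).mp (h.congr_fun fun xz => ?_)
  simp only [Function.comp_apply, Equiv.prodCongr_apply, Prod.map_fst, Prod.map_snd, Equiv.coe_addRight, add_sub_cancel_right, ht,
    ExpKernelCalculus.shiftK, add_neg_cancel_right]

/-- [our object] **THE TOTAL MASS OF THE GHOST STENCIL VANISHES**: `Σ'_{(x,z)} ghCur λ 0 x z = 0` (the two entries `+1`, `−1`). -/
theorem tsum_ghCur_eq_zero (lam : Fin 4) : ∑' xz : Site 4 × Site 4, ghCur lam 0 xz.1 xz.2 () () = 0 := by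
  have h := tsum_ghCur_mul lam fun _ _ => (1 : ℝ)
  simp only [mul_one, sub_self] at h
  exact h

/-- [folklore] LOCATED (leg-wise masses): a pure hopping current does NOT annihilate constants leg by leg — at the column site `0` the row-leg sum is
`Σ_x ghCur λ 0 x 0 = +1` (the single entry `x = e_λ`), at the row site `0` the column-leg sum is `−1`; only the TOTAL mass vanishes. -/
theorem ghCur_rowLeg (lam : Fin 4) :
    ghCur lam 0 (unitVec lam) 0 () () = 1 ∧ ghCur lam 0 0 (unitVec lam) () () = -1 ∧
      (∀ x, x ≠ unitVec lam → ghCur lam 0 x 0 () () = 0) ∧ (∀ z, z ≠ unitVec lam → ghCur lam 0 0 z () () = 0) := by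
  have hne : (unitVec lam : Site 4) ≠ 0 := unitVec_ne_zero lam
  refine ⟨?_, ?_, fun x hx => ?_, fun z hz => ?_⟩
  · rw [ghCur_apply, zero_add, if_pos ⟨rfl, rfl⟩, if_neg (fun h => hne h.1), sub_zero]
  · rw [ghCur_apply, zero_add, if_neg (fun h => hne h.2), if_pos ⟨rfl, rfl⟩, zero_sub]
  · rw [ghCur_apply, zero_add, if_neg (fun h => hx h.1), if_neg (fun h => hne h.2.symm), sub_zero]
  · rw [ghCur_apply, zero_add, if_neg (fun h => hne h.1.symm), if_neg (fun h => hz h.2), sub_zero]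

/-- [folklore] the coordinate of a frame vector: `(e_λ)_κ = [κ = λ]` as a real number, `= δ λ κ`. -/
theorem cast_unitVec_apply (lam κ : Fin 4) : (((unitVec lam : Site 4) κ : ℤ) : ℝ) = δ lam κ := by
  rw [unitVec_apply, δ]
  by_cases h : κ = lam
  · rw [if_pos h, if_pos h.symm, Int.cast_one]
  · rw [if_neg h, if_neg (Ne.symm h), Int.cast_zero]

/-- [our object] **THE CUBIC GERM OF THE UNIT-LATTICE GHOST STENCIL IS `ghostGerm`** — `p`-part `+δ_{λκ}` (the row leg `c̄` sits at `+e_λ`), `q`-part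
`−δ_{λκ}` (the column leg `c` sits at `+e_λ` in the entry with coefficient `−1`): `cubicGermOfSc ghCur = ghostGerm`, coefficient EXACTLY ONE. -/
theorem cubicGermOfSc_ghCur : cubicGermOfSc ghCur = ghostGerm := by
  funext lam κ i
  unfold cubicGermOfSc
  rw [tsum_ghCur_mul lam fun x z => (((if i = 0 then x κ else z κ : ℤ)) : ℝ), ghostGerm]
  fin_cases i
  · simp only [Fin.zero_eta, Fin.isValue, ↓reduceIte, Pi.zero_apply, Int.cast_zero, sub_zero, cast_unitVec_apply, sgn, one_mul]
  · simp only [Fin.mk_one, Fin.isValue, one_ne_zero, ↓reduceIte, Pi.zero_apply, Int.cast_zero, zero_sub, cast_unitVec_apply, sgn]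
    ring

/-- [our object] **THE GHOST LETTERS BY NAME** (what H2V-0's ghost slot `v := ghCur` carries into H2-ASM): localisation (a1) at every rate, translation
covariance (a2), antisymmetry, total mass zero, and the germ. -/
theorem ghost_letters :
    (∀ δ : ℝ, ∀ lam u, BiLoc (ghCur lam u) u u (Real.exp δ) δ) ∧ (∀ lam u v, ghCur lam (u + v) = shiftK (-v) (ghCur lam u)) ∧
      (∀ lam u x z, ghCur lam u z x () () = -ghCur lam u x z () ()) ∧ (∀ lam, ∑' xz : Site 4 × Site 4, ghCur lam 0 xz.1 xz.2 () () = 0) ∧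
        cubicGermOfSc ghCur = ghostGerm :=
  ⟨fun δ lam u => biLoc_ghCur lam u δ, fun lam u v => ghCur_translate lam u v, fun lam u x z => ghCur_antisymm lam u x z () (),
    tsum_ghCur_eq_zero, cubicGermOfSc_ghCur⟩

end Summit.QuantumFields.BalabanUV.Beta.FP.GhostCubicGerm
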